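import Literature.Geometry.DiscreteGeometry.ThreePointBoundGeneral
import Summits.Ventures.PackingBounds.SphericalCodes.ThreePointTight
import Summits.Ventures.PackingBounds.SphericalCodes.GhostTwentySeven
import Summits.Ventures.PackingBounds.SphericalCodes.TightFrameOfDesign

/-!
# `A(10, arccos 1/10) ≤ 26` from any exact three-point certificate of value exactly `27` — the master implication

Framing: lottery ticket; floor = certified bounds/negative ranges. Venture `PackingBounds` (cell
`pub-packcert`, recognition seat, T5.md §5/§9).

The Bachoc–Vallentin three-point bound at `(n, s) = (10, 1/10)` is exactly `27` (an exact rational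
certificate of value `27` exists and is verified outside the kernel: `certs/t5/`), so the bound itself
cannot exclude a 27-point code. This file proves, in the abstract language of
`Literature.….BachocVallentin.card_le_of_threePoint`, the IMPLICATION that turns such a certificate
into the strictly better bound: **if** a three-point certificate `(A, F, b₁₁, b₁₂, b₂₂)` for `s = 1/10` on
`ℝ¹⁰` has bound `1 + A(1) + b₁₁ + F(1,1,1) = 27`, univariate slack vanishing on `[-1, 1/10]` only at
`u ∈ {1/10, -1/2}`, and two-point part `A = A' + a₁·u + a₂·(10u² − 1)` with `a₁, a₂ > 0` and `A'` of
nonnegative two-point sums, **then** every spherical code in `ℝ¹⁰` with inner products `≤ 1/10` has at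
most `26` points (`card_le_26_of_tight_certificate`). Chain: `card_le_of_threePoint` (≤ 27) →
`tight_slack_eq_zero` (equality ⇒ slack zero and `Σ A = 0`) → inner products in `{1/10, -1/2}`, centred
(`pairSum_id_eq_norm_sq`), second moment `Σ⟨x,y⟩² = 27²/10` (`pairSum_sq_ge`, this file) → tight frame
(`sum_sq_inner_eq_of_pairSum_sq_eq`) → contradiction (`no_ghost_config_27`).

What remains OUTSIDE the kernel for the theorem `A(10, arccos 1/10) ≤ 26`: exhibiting the certificate's
`A', a₁, a₂, F, b` and checking its hypotheses (the sums-of-squares identities and the zero set of the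
slack) — done in exact rational arithmetic by two independent programs (T5.md §4–§6), not yet in Lean.
-/

noncomputable section

open Finset
open scoped RealInnerProductSpace BigOperators

namespace Summit.Ventures.PackingBounds.SphericalCodes

open Literature.Geometry.DiscreteGeometry

variable {E : Type*} [NormedAddCommGroup E] [InnerProductSpace ℝ E]

/-- Second-moment lower bound for unit vectors: `Σ_{x,y∈C} ⟨x,y⟩² ≥ |C|²/n` in a real inner product
space of finite dimension `n ≥ 1` (the positivity of the Gegenbauer `P₂` two-point sum). -/
theorem pairSum_sq_ge [FiniteDimensional ℝ E] (C : Finset E) (hC : ∀ x ∈ C, ‖x‖ = 1)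
    (hn : 0 < Module.finrank ℝ E) :
    (C.card : ℝ) ^ 2 / Module.finrank ℝ E ≤ ∑ x ∈ C, ∑ y ∈ C, (inner ℝ x y) ^ 2 := by
  classical
  let b : OrthonormalBasis (Fin (Module.finrank ℝ E)) ℝ E := stdOrthonormalBasis ℝ E
  have hnr : (0 : ℝ) < (Module.finrank ℝ E : ℝ) := by exact_mod_cast hn
  have hP : ∀ x y : E, inner ℝ x y = ∑ i, inner ℝ x (b i) * inner ℝ (b i) y := fun x y =>
    (b.sum_inner_mul_inner x y).symm
  -- Parseval twice: Σ_{x,y} ⟪x,y⟫² = Σ_{ij} M_ij²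
  have hsq : ∑ x ∈ C, ∑ y ∈ C, (inner ℝ x y) ^ 2
      = ∑ i, ∑ j, (∑ x ∈ C, inner ℝ x (b i) * inner ℝ x (b j)) ^ 2 := by
    have hxy : ∀ x y : E, (inner ℝ x y) ^ 2
        = ∑ i, ∑ j, (inner ℝ x (b i) * inner ℝ x (b j)) * (inner ℝ y (b i) * inner ℝ y (b j)) := by
      intro x y
      rw [sq, hP x y, Finset.sum_mul_sum]
      refine Finset.sum_congr rfl fun i _ => Finset.sum_congr rfl fun j _ => ?_
      rw [real_inner_comm (b i) y, real_inner_comm (b j) y]; ring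
    simp_rw [hxy]
    rw [Finset.sum_comm]
    conv_lhs => arg 2; ext y; rw [Finset.sum_comm]
    rw [Finset.sum_comm]
    refine Finset.sum_congr rfl fun i _ => ?_
    rw [Finset.sum_comm]
    conv_lhs => arg 2; ext y; rw [Finset.sum_comm]
    rw [Finset.sum_comm]
    refine Finset.sum_congr rfl fun j _ => ?_
    rw [sq, Finset.sum_mul_sum]
  -- trace: Σ_i M_ii = |C|
  have htr : ∑ i, (∑ x ∈ C, inner ℝ x (b i) * inner ℝ x (b i)) = (C.card : ℝ) := by
    rw [Finset.sum_comm]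
    have : ∀ x ∈ C, (∑ i, inner ℝ x (b i) * inner ℝ x (b i)) = 1 := by
      intro x hx
      have h := b.sum_inner_mul_inner x x
      have e : (∑ i, inner ℝ x (b i) * inner ℝ x (b i)) = ∑ i, inner ℝ x (b i) * inner ℝ (b i) x :=
        Finset.sum_congr rfl fun i _ => by nth_rewrite 2 [real_inner_comm (b i) x]; rfl
      rw [e, h, real_inner_self_eq_norm_sq, hC x hx]; norm_num
    rw [Finset.sum_congr rfl this, Finset.sum_const, nsmul_eq_mul, mul_one]
  -- with c := |C|/n:  0 ≤ Σ_ij (M_ij − c δ_ij)² = Σ M² − 2 c |C| + n c²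
  have key : ∀ c : ℝ, 0 ≤ (∑ x ∈ C, ∑ y ∈ C, (inner ℝ x y) ^ 2) - 2 * c * (C.card : ℝ)
      + (Module.finrank ℝ E : ℝ) * c ^ 2 := by
    intro c
    have hnonneg : 0 ≤ ∑ i, ∑ j,
        ((∑ x ∈ C, inner ℝ x (b i) * inner ℝ x (b j)) - if i = j then c else 0) ^ 2 :=
      Finset.sum_nonneg fun i _ => Finset.sum_nonneg fun j _ => sq_nonneg _
    have hexp : ∀ i j : Fin (Module.finrank ℝ E),
        ((∑ x ∈ C, inner ℝ x (b i) * inner ℝ x (b j)) - if i = j then c else 0) ^ 2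
        = (∑ x ∈ C, inner ℝ x (b i) * inner ℝ x (b j)) ^ 2
          - 2 * c * (if i = j then (∑ x ∈ C, inner ℝ x (b i) * inner ℝ x (b j)) else 0)
          + (if i = j then c ^ 2 else 0) := by
      intro i j
      by_cases hij : i = j
      · subst hij; simp; ring
      · simp [hij]
    simp_rw [hexp, Finset.sum_add_distrib, Finset.sum_sub_distrib] at hnonneg
    rw [← hsq] at hnonneg
    simp only [Finset.sum_ite_eq, Finset.mem_univ, if_true, ← Finset.mul_sum] at hnonneg
    rw [htr, Finset.sum_const, Finset.card_univ, Fintype.card_fin, nsmul_eq_mul] at hnonneg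
    linarith
  have h := key ((C.card : ℝ) / Module.finrank ℝ E)
  generalize hm : (Module.finrank ℝ E : ℝ) = m at h hnr ⊢
  generalize (C.card : ℝ) = N at h ⊢
  have hm0 : m ≠ 0 := hnr.ne'
  have e : 2 * (N / m) * N - m * (N / m) ^ 2 = N ^ 2 / m := by
    field_simp
    ring
  linarith

/-- **Master implication for the cell `(10, 1/10)`.** On `ℝ¹⁰ = EuclideanSpace ℝ (Fin 10)`: suppose `(A', a₁, a₂, F, b₁₁, b₁₂, b₂₂)` are the data of a three-point certificate at
`s = 1/10` in the abstract sense of `BachocVallentin.card_le_of_threePoint` — with two-point function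
`A(u) = A'(u) + a₁ u + a₂ (10u² − 1)`, `a₁, a₂ > 0`, `Σ_{x,y} A'(x·y) ≥ 0` and `Σ_{x,y,z} F ≥ 0` for every
finite family of unit vectors, `B ⪰ 0` as a quadratic form, the univariate condition (i) and the
trivariate condition (ii) — whose bound is EXACTLY `27` and whose univariate slack vanishes on
`[-1, 1/10]` only at `1/10` and `-1/2`. Then every finite set of unit vectors in `E` with pairwise inner
products `≤ 1/10` has at most `26` elements. -/
theorem card_le_26_of_tight_certificate
    (A' : ℝ → ℝ) (a₁ a₂ : ℝ) (ha₁ : 0 < a₁) (ha₂ : 0 < a₂)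
    (F : ℝ → ℝ → ℝ → ℝ) (b11 b12 b22 : ℝ)
    (hA' : ∀ D : Finset (EuclideanSpace ℝ (Fin 10)), (∀ x ∈ D, ‖x‖ = 1) → 0 ≤ BachocVallentin.pairSum D A')
    (hF : ∀ D : Finset (EuclideanSpace ℝ (Fin 10)), (∀ x ∈ D, ‖x‖ = 1) → 0 ≤ BachocVallentin.tripleSum D F)
    (hF12 : ∀ u v t, F u v t = F v u t) (hF23 : ∀ u v t, F u v t = F u t v)
    (hb : ∀ l : ℝ, 0 ≤ b11 + 2 * b12 * l + b22 * l ^ 2)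
    (h1 : ∀ u : ℝ, -1 ≤ u → u ≤ 1 / 10 →
      (A' u + a₁ * u + a₂ * (10 * u ^ 2 - 1)) + 3 * F u u 1 ≤ -1 - 2 * b12 - b22)
    (h2 : ∀ u v t : ℝ, -1 ≤ u → u ≤ 1 / 10 → -1 ≤ v → v ≤ 1 / 10 → -1 ≤ t → t ≤ 1 / 10 →
      0 ≤ 1 + 2 * u * v * t - u ^ 2 - v ^ 2 - t ^ 2 → F u v t ≤ -b22)
    (hbound : 1 + (A' 1 + a₁ * 1 + a₂ * (10 * 1 ^ 2 - 1)) + b11 + F 1 1 1 = 27)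
    (hzero : ∀ u : ℝ, -1 ≤ u → u ≤ 1 / 10 →
      (A' u + a₁ * u + a₂ * (10 * u ^ 2 - 1)) + 3 * F u u 1 = -1 - 2 * b12 - b22 →
      u = 1 / 10 ∨ u = -1 / 2)
    (C : Finset (EuclideanSpace ℝ (Fin 10))) (hC : ∀ x ∈ C, ‖x‖ = 1)
    (hcode : ∀ x ∈ C, ∀ y ∈ C, x ≠ y → inner ℝ x y ≤ (1 / 10 : ℝ)) : C.card ≤ 26 := by
  classical
  set A : ℝ → ℝ := fun u => A' u + a₁ * u + a₂ * (10 * u ^ 2 - 1) with hAdef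
  -- nonnegativity of the two-point sum of A on C, split into its three parts
  have hPid : BachocVallentin.pairSum C (fun u => u) = ‖∑ x ∈ C, x‖ ^ 2 := pairSum_id_eq_norm_sq C
  have hP2 : BachocVallentin.pairSum C (fun u => 10 * u ^ 2 - 1)
      = 10 * (∑ x ∈ C, ∑ y ∈ C, (inner ℝ x y) ^ 2) - (C.card : ℝ) ^ 2 := by
    unfold BachocVallentin.pairSum
    simp only [Finset.sum_sub_distrib, Finset.sum_const, nsmul_eq_mul, mul_one, ← Finset.mul_sum]
    ring
  have hdim : Module.finrank ℝ (EuclideanSpace ℝ (Fin 10)) = 10 := finrank_euclideanSpace_fin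
  have hn10 : 0 < Module.finrank ℝ (EuclideanSpace ℝ (Fin 10)) := by rw [hdim]; norm_num
  have hmom := pairSum_sq_ge C hC hn10
  rw [hdim] at hmom
  have hP2nonneg : 0 ≤ BachocVallentin.pairSum C (fun u => 10 * u ^ 2 - 1) := by
    rw [hP2]
    have : (C.card : ℝ) ^ 2 / (10 : ℕ) * 10 ≤ (∑ x ∈ C, ∑ y ∈ C, (inner ℝ x y) ^ 2) * 10 :=
      mul_le_mul_of_nonneg_right hmom (by norm_num)
    push_cast at this
    linarith
  have hsplit : BachocVallentin.pairSum C A = BachocVallentin.pairSum C A'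
      + a₁ * BachocVallentin.pairSum C (fun u => u)
      + a₂ * BachocVallentin.pairSum C (fun u => 10 * u ^ 2 - 1) := by
    unfold BachocVallentin.pairSum
    simp only [hAdef, Finset.sum_add_distrib, Finset.mul_sum]
  have hA : 0 ≤ BachocVallentin.pairSum C A := by
    rw [hsplit]
    have := hA' C hC
    have h2' : 0 ≤ BachocVallentin.pairSum C (fun u => u) := by rw [hPid]; positivity
    positivity
  -- the bound: card ≤ 27
  have hAone : 1 + A 1 + b11 + F 1 1 1 = 27 := by simp only [hAdef]; linarith [hbound]
  have hle : (C.card : ℝ) ≤ 1 + A 1 + b11 + F 1 1 1 :=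
    BachocVallentin.card_le_of_threePoint (1 / 10) C hC hcode A F b11 b12 b22 hA (hF C hC) hF12 hF23 hb
      (fun u hu hu' => by simp only [hAdef]; exact h1 u hu hu')
      h2 (by rw [hAone]; norm_num)
  rw [hAone] at hle
  have hle27 : C.card ≤ 27 := by exact_mod_cast hle
  -- equality is impossible
  by_contra hgt
  have hcard : C.card = 27 := by omega
  have htight : (C.card : ℝ) = 1 + A 1 + b11 + F 1 1 1 := by rw [hAone, hcard]; norm_num
  obtain ⟨hslack, hA0, -⟩ := tight_slack_eq_zero (1 / 10) C hC hcode A F b11 b12 b22 hA (hF C hC)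
    hF12 hF23 hb (fun u hu hu' => by simp only [hAdef]; exact h1 u hu hu') h2 htight
  -- (1) inner products of distinct points are 1/10 or −1/2
  have hval : ∀ x ∈ C, ∀ y ∈ C, x ≠ y → inner ℝ x y = (1 / 10 : ℝ) ∨ inner ℝ x y = (-1 / 2 : ℝ) := by
    intro x hx y hy hxy
    have hs := hslack x hx y hy hxy
    have hlo : -1 ≤ inner ℝ x y := by
      have h := abs_real_inner_le_norm x y
      rw [hC x hx, hC y hy, mul_one] at h
      exact (abs_le.1 h).1
    refine hzero _ hlo (hcode x hx y hy hxy) ?_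
    simp only [hAdef] at hs
    linarith
  -- (2) the three parts of Σ A vanish: centred and second moment 27²/10
  rw [hsplit] at hA0
  have hA'0 := hA' C hC
  have hid0 : 0 ≤ BachocVallentin.pairSum C (fun u => u) := by rw [hPid]; positivity
  have hidz : BachocVallentin.pairSum C (fun u => u) = 0 := by
    by_contra hne
    have hpos : 0 < BachocVallentin.pairSum C (fun u => u) := lt_of_le_of_ne hid0 (Ne.symm hne)
    have := mul_pos ha₁ hpos
    have := mul_nonneg ha₂.le hP2nonneg
    linarith
  have hP2z : BachocVallentin.pairSum C (fun u => 10 * u ^ 2 - 1) = 0 := by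
    by_contra hne
    have hpos : 0 < BachocVallentin.pairSum C (fun u => 10 * u ^ 2 - 1) := lt_of_le_of_ne hP2nonneg (Ne.symm hne)
    have := mul_pos ha₂ hpos
    have := mul_nonneg ha₁.le hid0
    linarith
  have hsum0 : ∑ x ∈ C, x = 0 := by
    rw [hPid] at hidz
    exact norm_eq_zero.1 (pow_eq_zero_iff (n := 2) (by norm_num) |>.1 hidz)
  have hcent : ∀ y ∈ C, ∑ x ∈ C, inner ℝ x y = 0 := by
    intro y _
    rw [← sum_inner, hsum0, inner_zero_left]
  have hsq : ∑ x ∈ C, ∑ y ∈ C, (inner ℝ x y) ^ 2 = (C.card : ℝ) ^ 2 / Module.finrank ℝ (EuclideanSpace ℝ (Fin 10)) := by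
    rw [hP2] at hP2z; rw [hdim]; push_cast; linarith
  have hframe : ∀ v : EuclideanSpace ℝ (Fin 10), ∑ x ∈ C, (inner ℝ x v) ^ 2 = (27 / 10 : ℝ) * ‖v‖ ^ 2 := by
    intro v
    have h := sum_sq_inner_eq_of_pairSum_sq_eq C hC hn10 hsq v
    rw [hdim, hcard] at h
    convert h using 2; norm_num
  exact no_ghost_config_27 C hcard hC hval hcent hframe

end Summit.Ventures.PackingBounds.SphericalCodes

end
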